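import Mathlib
import Summits.NavierStokesRegularity.NavierStokesRegularity.Theorems.EulerZoomLiouvillePowerGaugeEulerLiouvilleSelfSimilarPressureParkingAverage
import HarnessLib

/-!
# Sub-quadratic ball averages of the profile pressure from DYADIC `L^{3/2}` growth (the form available for PAST members) — T2 lane tool
# (crux `EulerZoomLiouville.PowerGaugeEulerLiouville` = stmt-NavierStokesRegularity-19832; LEAD ns-typeII-p2 g12 v75 «past twin please»; width seat ns-ezl-w1 g4)

Route №10 `EulerZoomLiouville` (NavierStokesRegularity).  `PressureParking.integral_probeBump_pressure_le` (p645610) derives the sub-quadratic ball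
averages `∫ χ_R(y) P′(x₀+y) dy ≤ κL² + C L^{1−2ρ}/R³` from the WEIGHTED `D`-datum `∫ |P′|^{3/2}‖y‖^{2ρ−2} < ∞`, which an origin-anchored exactly
self-similar member has (`profile_pressure_weight_of_gaugeD`: the parabolic window reaches the collapse time).  A genuinely PAST member
(representation only for `τ < T₁ < T`) never shows its profile near the collapse, and the `D`-gauge then yields only the DYADIC growth
`∫_{B_L} |P′|^{3/2} ≤ C_D L^{2−2ρ}` (indeed `F(L) = L^{2−2ρ}/log L` is class-compatible there while the weighted datum diverges).  This file
re-derives the averaging lemma from the dyadic growth alone — the input the past twin of the T2 strata needs: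

* `setIntegral_le_of_localMass` — Hölder on a set `A`: `∫_A η ≤ M^{2/3} |A|^{1/3}` from `∫⁻_A ‖η‖ₑ^{3/2} ≤ M`;
* `volume_high_inter_ball_le_of_growth` — Chebyshev: `|{κL² < η} ∩ B_{5L}| ≤ C_D 5^{2−2ρ} κ^{−3/2} L^{−1−2ρ}`;
* `integral_probeBump_pressure_le_of_growth` — the same conclusion as `integral_probeBump_pressure_le` under the growth hypothesis.

HONEST LABEL: tool.  WHAT THIS IS NOT: not NS, not E — `--supports` stmt-19832; 19832 OPEN. [folklore; CaffarelliKohnNirenberg1982 §2]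
-/

noncomputable section

-- flat `Theorems/<Route><Decl>…` files of one crux share the namespace of the crux (tree convention)
set_option linter.dupNamespace false

open MeasureTheory Set Filter Topology Metric Function InnerProductSpace TopologicalSpace
open scoped RealInnerProductSpace NNReal ENNReal

namespace Summit.NavierStokesRegularity.NavierStokesRegularity.Theorems.PowerGaugeEulerLiouville.PressureParking

open Literature.Analysis Literature.Analysis.FluidPDE

/-- **Hölder `(3/2, 3)` on a bounded set from a local `L^{3/2}` mass**: for a continuous `η ≥ 0` on a measurable `A ⊆ B_r`
with `∫⁻_A ‖η‖ₑ^{3/2} ≤ M`, `∫_A η ≤ M^{2/3} |A|^{1/3}`. [folklore] -/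
theorem setIntegral_le_of_localMass {η : EuclideanSpace ℝ (Fin 3) → ℝ} (hη : Continuous η) {M : ℝ} (hM : 0 ≤ M)
    {A : Set (EuclideanSpace ℝ (Fin 3))} (hA : MeasurableSet A) {r : ℝ}
    (hAr : A ⊆ ball (0 : EuclideanSpace ℝ (Fin 3)) r) (hη0 : ∀ z ∈ A, 0 ≤ η z)
    (hmass : ∫⁻ y in A, ‖η y‖ₑ ^ (3 / 2 : ℝ) ≤ ENNReal.ofReal M) :
    ∫ z in A, η z ≤ M ^ (2 / 3 : ℝ) * (volume A).toReal ^ (1 / 3 : ℝ) := by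
  have h32 : (3 / 2 : ℝ).HolderConjugate 3 := by rw [Real.holderConjugate_iff]; norm_num
  have hf : AEMeasurable (fun y => ‖η y‖ₑ) (volume.restrict A) := hη.aemeasurable.enorm.restrict
  have hH := ENNReal.lintegral_mul_le_Lp_mul_Lq (volume.restrict A) h32 hf (g := fun _ => 1) aemeasurable_const
  simp only [Pi.mul_apply, mul_one, ENNReal.one_rpow, lintegral_const, Measure.restrict_apply_univ, one_div,
    one_mul] at hH
  rw [show ((3 : ℝ) / 2)⁻¹ = 2 / 3 by norm_num, show (3 : ℝ)⁻¹ = 1 / 3 by norm_num] at hH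
  have hvolA : volume A < ⊤ := (measure_mono hAr).trans_lt measure_ball_lt_top
  have heq : ∫ z in A, η z = (∫⁻ z in A, ‖η z‖ₑ).toReal := by
    rw [integral_eq_lintegral_of_nonneg_ae ((ae_restrict_mem hA).mono fun z hz => hη0 z hz)
      hη.aestronglyMeasurable.restrict]
    congr 1
    refine lintegral_congr_ae ((ae_restrict_mem hA).mono fun z hz => ?_)
    dsimp only
    rw [← ofReal_norm, Real.norm_of_nonneg (hη0 z hz)]
  rw [heq]
  have hfin : (∫⁻ y in A, ‖η y‖ₑ ^ (3 / 2 : ℝ)) ^ (2 / 3 : ℝ) * volume A ^ (1 / 3 : ℝ) ≠ ⊤ :=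
    ENNReal.mul_ne_top (ENNReal.rpow_ne_top_of_nonneg (by norm_num) (ne_top_of_le_ne_top ENNReal.ofReal_ne_top hmass))
      (ENNReal.rpow_ne_top_of_nonneg (by norm_num) hvolA.ne)
  calc (∫⁻ z in A, ‖η z‖ₑ).toReal
      ≤ ((∫⁻ y in A, ‖η y‖ₑ ^ (3 / 2 : ℝ)) ^ (2 / 3 : ℝ) * volume A ^ (1 / 3 : ℝ)).toReal :=
        ENNReal.toReal_mono hfin hH
    _ ≤ ((ENNReal.ofReal M) ^ (2 / 3 : ℝ) * volume A ^ (1 / 3 : ℝ)).toReal := by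
        refine ENNReal.toReal_mono ?_ (by gcongr)
        exact ENNReal.mul_ne_top (ENNReal.rpow_ne_top_of_nonneg (by norm_num) ENNReal.ofReal_ne_top)
          (ENNReal.rpow_ne_top_of_nonneg (by norm_num) hvolA.ne)
    _ = M ^ (2 / 3 : ℝ) * (volume A).toReal ^ (1 / 3 : ℝ) := by
        rw [ENNReal.toReal_mul, ← ENNReal.toReal_rpow, ← ENNReal.toReal_rpow, ENNReal.toReal_ofReal hM]

/-- **Chebyshev for the pressure-high set from dyadic growth**: if `∫_{B_{5L}} |η|^{3/2} ≤ C_D (5L)^{2−2ρ}` then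
`|{κL² < η} ∩ B_{5L}| ≤ C_D 5^{2−2ρ} κ^{−3/2} · L^{−1−2ρ}` (`κ, L > 0`). [folklore] -/
theorem volume_high_inter_ball_le_of_growth {η : EuclideanSpace ℝ (Fin 3) → ℝ} (hη : Continuous η) {ρ CD κ L : ℝ}
    (hCD : 0 ≤ CD) (hκ : 0 < κ) (hL : 0 < L)
    (hgrowth : ∫⁻ y in ball (0 : EuclideanSpace ℝ (Fin 3)) (5 * L), ‖η y‖ₑ ^ (3 / 2 : ℝ) ≤
      ENNReal.ofReal (CD * (5 * L) ^ (2 - 2 * ρ))) :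
    (volume ({y : EuclideanSpace ℝ (Fin 3) | κ * L ^ 2 < η y} ∩ ball (0 : EuclideanSpace ℝ (Fin 3)) (5 * L))).toReal ≤
      CD * (5 : ℝ) ^ (2 - 2 * ρ) * κ ^ (-(3 / 2 : ℝ)) * L ^ (-1 - 2 * ρ) := by
  have hκL : 0 < κ * L ^ 2 := by positivity
  set ε : ℝ≥0∞ := ENNReal.ofReal ((κ * L ^ 2) ^ (3 / 2 : ℝ)) with hεdef
  have hε0 : ε ≠ 0 := (ENNReal.ofReal_pos.2 (Real.rpow_pos_of_pos hκL _)).ne'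
  have hεtop : ε ≠ ⊤ := ENNReal.ofReal_ne_top
  set μ : Measure (EuclideanSpace ℝ (Fin 3)) := volume.restrict (ball (0 : EuclideanSpace ℝ (Fin 3)) (5 * L)) with hμ
  have hf : AEMeasurable (fun y => ‖η y‖ₑ ^ (3 / 2 : ℝ)) μ := (hη.aemeasurable.enorm.pow_const _).restrict
  have hcheb := meas_ge_le_lintegral_div hf hε0 hεtop
  -- `{κL² < η} ∩ B_{5L} ⊆ {ε ≤ ‖η‖ₑ^{3/2}}` (in `μ`-measure)
  have hsub : volume ({y : EuclideanSpace ℝ (Fin 3) | κ * L ^ 2 < η y} ∩ ball (0 : EuclideanSpace ℝ (Fin 3)) (5 * L)) ≤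
      μ {y | ε ≤ ‖η y‖ₑ ^ (3 / 2 : ℝ)} := by
    rw [hμ, Measure.restrict_apply' measurableSet_ball]
    refine measure_mono fun y hy => ⟨?_, hy.2⟩
    have hηy : κ * L ^ 2 < η y := hy.1
    have hηpos : 0 ≤ η y := hκL.le.trans hηy.le
    show ε ≤ ‖η y‖ₑ ^ (3 / 2 : ℝ)
    rw [hεdef, Real.enorm_eq_ofReal hηpos, ENNReal.ofReal_rpow_of_nonneg hηpos (by norm_num)]
    exact ENNReal.ofReal_le_ofReal (Real.rpow_le_rpow hκL.le hηy.le (by norm_num))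
  have hbound : volume ({y : EuclideanSpace ℝ (Fin 3) | κ * L ^ 2 < η y} ∩ ball (0 : EuclideanSpace ℝ (Fin 3)) (5 * L)) ≤
      ENNReal.ofReal (CD * (5 * L) ^ (2 - 2 * ρ)) / ε :=
    hsub.trans (hcheb.trans (ENNReal.div_le_div_right hgrowth _))
  refine (ENNReal.toReal_mono (ENNReal.div_ne_top ENNReal.ofReal_ne_top hε0) hbound).trans (le_of_eq ?_)
  rw [ENNReal.toReal_div, ENNReal.toReal_ofReal (by positivity), hεdef,
    ENNReal.toReal_ofReal (Real.rpow_nonneg hκL.le _), Real.mul_rpow (by norm_num) hL.le,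
    Real.mul_rpow hκ.le (pow_nonneg hL.le 2), ← Real.rpow_natCast L 2, ← Real.rpow_mul hL.le, Real.rpow_neg hκ.le]
  have hL1 : L ^ (2 - 2 * ρ) = L ^ ((2 : ℕ) * (3 / 2 : ℝ)) * L ^ (-1 - 2 * ρ) := by
    rw [← Real.rpow_add hL]; norm_num; ring_nf
  rw [hL1]
  have hκne : κ ^ (3 / 2 : ℝ) ≠ 0 := (Real.rpow_pos_of_pos hκ _).ne'
  have hLne : L ^ ((2 : ℕ) * (3 / 2 : ℝ)) ≠ 0 := (Real.rpow_pos_of_pos hL _).ne'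
  field_simp

/-- **SUB-QUADRATIC BALL AVERAGES FROM DYADIC GROWTH** (the past-compatible form of `integral_probeBump_pressure_le`): for a `C²` self-similar
Euler profile `(V, P′)`, `ρ < 1`, and the dyadic growth `∫_{B_L} |P′|^{3/2} ≤ C_D L^{2−2ρ}` for `L ≥ L₀`, every `κ > 0` admits `C ≥ 0`, `L₁ ≥ 1`
with `∫ χ_R(y) P′(x₀+y) dy ≤ κL² + C L^{1−2ρ}/R³` for `L ≥ L₁`, `‖x₀‖ ≤ L`, `0 < R ≤ L`. [folklore; CaffarelliKohnNirenberg1982 §2] -/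
theorem integral_probeBump_pressure_le_of_growth {ρ γ : ℝ} {c : EuclideanSpace ℝ (Fin 3)}
    {V : EuclideanSpace ℝ (Fin 3) → EuclideanSpace ℝ (Fin 3)} {P' : EuclideanSpace ℝ (Fin 3) → ℝ}
    (hprof : IsSelfSimilarEulerProfile γ c V P') {CD L₀ : ℝ} (hCD : 0 ≤ CD)
    (hgrowth : ∀ L : ℝ, L₀ ≤ L → ∫⁻ y in ball (0 : EuclideanSpace ℝ (Fin 3)) L, ‖P' y‖ₑ ^ (3 / 2 : ℝ) ≤
      ENNReal.ofReal (CD * L ^ (2 - 2 * ρ))) {κ : ℝ} (hκ : 0 < κ) :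
    ∃ C L₁ : ℝ, 0 ≤ C ∧ 1 ≤ L₁ ∧ ∀ L : ℝ, L₁ ≤ L → ∀ x₀ : EuclideanSpace ℝ (Fin 3), ‖x₀‖ ≤ L →
      ∀ R : ℝ, 0 < R → R ≤ L →
        ∫ y, probeBump R y * P' (x₀ + y) ≤ κ * L ^ 2 + C * L ^ (1 - 2 * ρ) / R ^ 3 := by
  have hm : 0 < baseBumpMass (EuclideanSpace ℝ (Fin 3)) := baseBumpMass_pos
  have hPc : Continuous P' := hprof.contDiff_pressure.continuous
  set CP : ℝ := CD * (5 : ℝ) ^ (2 - 2 * ρ) * κ ^ (-(3 / 2 : ℝ)) with hCPdef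
  have hCP : 0 ≤ CP := by rw [hCPdef]; positivity
  set C₀ : ℝ := CD ^ (2 / 3 : ℝ) * (5 : ℝ) ^ ((2 - 2 * ρ) * (2 / 3)) * CP ^ (1 / 3 : ℝ) with hC₀
  have hC₀0 : 0 ≤ C₀ := by positivity
  refine ⟨C₀ / baseBumpMass (EuclideanSpace ℝ (Fin 3)), max 1 L₀, by positivity, le_max_left _ _,
    fun L hL x₀ hx₀ R hR hRL => ?_⟩
  have hL1 : 1 ≤ L := (le_max_left _ _).trans hL
  have hL0 : 0 < L := by linarith
  have hLL₀ : L₀ ≤ 5 * L := ((le_max_right _ _).trans hL).trans (by linarith)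
  have hκL : 0 ≤ κ * L ^ 2 := by positivity
  have hgr := hgrowth (5 * L) hLL₀
  -- the level-`κL²` average bound
  have havg := integral_probeBump_mul_comp_add_le hPc hR hκL x₀
  set A : Set (EuclideanSpace ℝ (Fin 3)) := ball x₀ (2 * R) ∩ {z | κ * L ^ 2 < P' z} with hAdef
  have hAm : MeasurableSet A := measurableSet_ball.inter (isOpen_lt continuous_const hPc).measurableSet
  have hA5 : A ⊆ ball (0 : EuclideanSpace ℝ (Fin 3)) (5 * L) := fun z hz => by
    rw [mem_ball_zero_iff]
    have h1 : ‖z - x₀‖ < 2 * R := by rw [← dist_eq_norm]; exact hz.1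
    calc ‖z‖ = ‖(z - x₀) + x₀‖ := by rw [sub_add_cancel]
      _ ≤ ‖z - x₀‖ + ‖x₀‖ := norm_add_le _ _
      _ < 2 * R + L := add_lt_add_of_lt_of_le h1 hx₀
      _ ≤ 5 * L := by linarith
  have hAsub : A ⊆ {y : EuclideanSpace ℝ (Fin 3) | κ * L ^ 2 < P' y} ∩ ball (0 : EuclideanSpace ℝ (Fin 3)) (5 * L) :=
    fun z hz => ⟨hz.2, hA5 hz⟩
  have hvolA : (volume A).toReal ≤ CP * L ^ (-1 - 2 * ρ) := by
    have h := volume_high_inter_ball_le_of_growth hPc hCD hκ hL0 hgr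
    rw [← hCPdef] at h
    exact (ENNReal.toReal_mono ((measure_mono inter_subset_right).trans_lt measure_ball_lt_top).ne
      (measure_mono hAsub)).trans h
  -- Hölder from the local mass on `A ⊆ B_{5L}`
  have hmassA : ∫⁻ y in A, ‖P' y‖ₑ ^ (3 / 2 : ℝ) ≤ ENNReal.ofReal (CD * (5 * L) ^ (2 - 2 * ρ)) :=
    (lintegral_mono_set hA5).trans hgr
  have hHol := setIntegral_le_of_localMass hPc (by positivity) hAm hA5 (fun z hz => hκL.trans hz.2.le) hmassA
  have hbound : ∫ z in A, P' z ≤ C₀ * L ^ (1 - 2 * ρ) := by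
    calc ∫ z in A, P' z ≤ (CD * (5 * L) ^ (2 - 2 * ρ)) ^ (2 / 3 : ℝ) * (volume A).toReal ^ (1 / 3 : ℝ) := hHol
      _ ≤ (CD * (5 * L) ^ (2 - 2 * ρ)) ^ (2 / 3 : ℝ) * (CP * L ^ (-1 - 2 * ρ)) ^ (1 / 3 : ℝ) := by
          gcongr
      _ = C₀ * L ^ (1 - 2 * ρ) := by rw [average_bookkeeping hCD hCP hL0, hC₀]
  have hR3 : 0 < R ^ 3 := by positivity
  calc ∫ y, probeBump R y * P' (x₀ + y)
      ≤ κ * L ^ 2 + (baseBumpMass (EuclideanSpace ℝ (Fin 3)) * R ^ 3)⁻¹ * ∫ z in A, P' z := havg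
    _ ≤ κ * L ^ 2 + (baseBumpMass (EuclideanSpace ℝ (Fin 3)) * R ^ 3)⁻¹ * (C₀ * L ^ (1 - 2 * ρ)) := by
        gcongr
    _ = κ * L ^ 2 + C₀ / baseBumpMass (EuclideanSpace ℝ (Fin 3)) * L ^ (1 - 2 * ρ) / R ^ 3 := by
        field_simp

end Summit.NavierStokesRegularity.NavierStokesRegularity.Theorems.PowerGaugeEulerLiouville.PressureParking

end
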